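import Literature.AlgebraicGeometry.Motives.HodgeNumberHarmonicFrames
import Literature.AlgebraicGeometry.Motives.HodgeDecompositionHarmonicRepresentativeProofs
import Literature.Analysis.OperatorTheory.PerturbedSubspaceLimit
import Literature.Geometry.Kaehler.L2InnerTransport
import Literature.Geometry.Kaehler.TypeProjectorTransport
import Literature.NumberTheory.Transcendental.DeRhamTheorem
import HarnessLib

/-!
# Upper semicontinuity of the Hodge numbers under almost holomorphic, almost isometric transport

Topic: Hodge numbers in families (Voisin (2002), §9.3; Kodaira–Spencer). The classical proof of the
upper semicontinuity `h^{p,q}(X_s) ≤ h^{p,q}(X_{s₀})` for `s` near `s₀` in a family of compact complex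
manifolds (Voisin (2002), §9.3.2, Prop. 9.20 / Thm. 9.23, via the semicontinuity of the kernel of a
family of elliptic operators, Thm. 9.15) needs uniform elliptic estimates in the parameter. For
*Kähler* fibres the following **soft argument** suffices, and this file proves it, in sequential
form and for abstract transport data:

let `(M₀, g₀)` be a compact Kähler manifold and `(M_i, g_i)` compact Kähler manifolds with
diffeomorphisms `Φ_i : M₀ → M_i` whose differentials have Gram defect `≤ δ_i → 0` on an oriented
orthonormal frame field of `M₀` (so `Φ_i` is almost isometric) and commutators with the complex
structures `‖J_i DΦ_i - DΦ_i J₀‖ ≤ κ_i → 0` (almost holomorphic). If every `M_i` carries `N`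
independent classes in `K^{p,q} = hodgePQ` then so does `M₀`:
`le_finrank_hodgePQ_of_transport`.

Proof (all ingredients are theorems of the tree). On `V = A^k(M₀; ℂ)` with the `L²` product of
`g₀` (`CL2SmoothForms`), let `H` = harmonic forms (finite-dimensional, `⊥` the exact forms `D`),
`L` = the type projector `w ↦ w^{p,q}` (bounded, `exists_typeProjector_clm`), `W_i` = the span of
the transports `Φ_i^* u` of `N` independent harmonic `(p,q)`-forms `u` of `M_i`
(`exists_linearIndependent_isCHarmonicForm_isOfType`), and `B_i(d, w) = ((Φ_i⁻¹)^*d, (Φ_i⁻¹)^*w)_{L²(M_i)}`.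
Then `W_i ⊆ H ⊕ D` (Hodge decomposition on `M₀`), `B_i(D, W_i) = 0` (harmonic `⊥` exact on `M_i`),
`|B_i - ( , )_{L²(M₀)}| ≤ ε_i (‖·‖² + ‖·‖²)` with `ε_i → 0` (`exists_forall_norm_cl2Inner_transport_sub_le`),
and `‖w - Lw‖ ≤ η_i ‖w‖` on `W_i` with `η_i → 0` (`re_cl2Inner_typeDefect_le`). The abstract limiting
lemma `exists_linearIndependent_of_subspaces` (`Analysis/OperatorTheory/PerturbedSubspaceLimit`)
produces `N` independent harmonic forms fixed by `L`, i.e. of type `(p,q)`, whence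
`N ≤ dim K^{p,q}(M₀)` (`le_finrank_hodgePQ_of_linearIndependent`).

## References

* C. Voisin, *Hodge Theory and Complex Algebraic Geometry I*, CUP (2002), §9.3.2, Prop. 9.20 and
  Thm. 9.23 (upper semicontinuity of `h^{p,q}`), §5.1–§6.1 (harmonic forms, Hodge decomposition);
  held text `book:voisin2002-hodge-theory-complex-algebraic-geometry-i`, PDF pp. 194–198.
  [cite: VoisinHodgeI2002, §9.3.2 Prop. 9.20]
* K. Kodaira, *Complex Manifolds and Deformation of Complex Structures* (1986/2005), §7.2, Thm. 7.3.
-/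

noncomputable section

open scoped Manifold ContDiff Topology InnerProductSpace
open Bundle Module Set Filter Function
open Literature.Geometry.Kaehler Literature.NumberTheory.Transcendental Literature.Analysis.OperatorTheory

namespace Literature.AlgebraicGeometry.Motives

-- The identification `TangentSpace I x = E` is an abuse of definitional equality (see
-- `NormedSpace.fromTangentSpace`); as in Mathlib's tangent-bundle files we let `isDefEq` unfold it.
set_option backward.isDefEq.respectTransparency false

universe u v

variable {E₀ : Type*} [NormedAddCommGroup E₀] [NormedSpace ℂ E₀] [FiniteDimensional ℂ E₀]
  {M₀ : Type*} [TopologicalSpace M₀] [ChartedSpace E₀ M₀] [IsManifold 𝓘(ℝ, E₀) ∞ M₀]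
  [IsManifold 𝓘(ℂ, E₀) ω M₀] [T2Space M₀] [CompactSpace M₀] {n : ℕ} [Fact (finrank ℝ E₀ = n)]
  [MeasurableSpace E₀] [BorelSpace E₀]
  (g₀ : ContMDiffRiemannianMetric 𝓘(ℝ, E₀) ∞ E₀ (fun x : M₀ ↦ TangentSpace 𝓘(ℝ, E₀) x))
  (o₀ : (x : M₀) → Orientation ℝ (TangentSpace 𝓘(ℝ, E₀) x) (Fin n))

/-- **Upper semicontinuity of `dim K^{p,q}` under almost holomorphic, almost isometric transport**
(the soft form of Voisin (2002), Prop. 9.20 / Thm. 9.23 for Kähler fibres; see the module docstring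
for the statement in words and the proof). Data: a compact Kähler `(M₀, g₀, o₀)` (holomorphic atlas,
`vol_{o₀}` smooth, an `o₀`-oriented `g₀`-orthonormal frame `b x` at every point), degrees `k + m = n`,
a type `(p, q)`, and for every `i : ℕ` a compact Kähler `(M_i, g_i, o_i)` of the same dimension with a
diffeomorphism `Φ_i : M₀ → M_i` compatible with the orientations, such that
`|g_i(DΦ_i b_j, DΦ_i b_l) - δ_{jl}| ≤ δ_i` and `‖J_i ∘ DΦ_i - DΦ_i ∘ J₀‖ ≤ κ_i` everywhere, with
`δ_i, κ_i → 0`. Conclusion: if `N ≤ dim K^{p,q}(M_i)` for all `i`, then `N ≤ dim K^{p,q}(M₀)`.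
[cite: VoisinHodgeI2002, §9.3.2 Prop. 9.20] -/
theorem le_finrank_hodgePQ_of_transport (hg₀ : g₀.toRiemannianMetric.IsKaehler)
    {k m : ℕ} (h : k + m = n) (p q : ℕ)
    (Em : ℕ → Type u) [∀ i, NormedAddCommGroup (Em i)] [∀ i, NormedSpace ℂ (Em i)]
    [∀ i, FiniteDimensional ℂ (Em i)] [∀ i, Fact (finrank ℝ (Em i) = n)]
    [∀ i, MeasurableSpace (Em i)] [∀ i, BorelSpace (Em i)]
    (Mf : ℕ → Type v) [∀ i, TopologicalSpace (Mf i)] [∀ i, ChartedSpace (Em i) (Mf i)]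
    [∀ i, IsManifold 𝓘(ℝ, Em i) ∞ (Mf i)] [∀ i, IsManifold 𝓘(ℂ, Em i) ω (Mf i)]
    [∀ i, T2Space (Mf i)] [∀ i, CompactSpace (Mf i)]
    (g : ∀ i, ContMDiffRiemannianMetric 𝓘(ℝ, Em i) ∞ (Em i) (fun y : Mf i ↦ TangentSpace 𝓘(ℝ, Em i) y))
    (hg : ∀ i, (g i).toRiemannianMetric.IsKaehler)
    (o : ∀ i, (y : Mf i) → Orientation ℝ (TangentSpace 𝓘(ℝ, Em i) y) (Fin n))
    (Φ : ∀ i, Diffeomorph 𝓘(ℝ, E₀) 𝓘(ℝ, Em i) M₀ (Mf i) ∞)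
    (δ κ : ℕ → ℝ) (hδ0 : ∀ i, 0 ≤ δ i) (hκ0 : ∀ i, 0 ≤ κ i)
    (hδ : Tendsto δ atTop (𝓝 0)) (hκ : Tendsto κ atTop (𝓝 0)) {N : ℕ} :
    letI : RiemannianBundle (fun x : M₀ ↦ TangentSpace 𝓘(ℝ, E₀) x) := ⟨g₀.toRiemannianMetric⟩
    letI : ∀ i, RiemannianBundle (fun y : Mf i ↦ TangentSpace 𝓘(ℝ, Em i) y) :=
      fun i ↦ ⟨(g i).toRiemannianMetric⟩
    IsSmoothForm (riemannianVolumeForm o₀) → (∀ i, IsSmoothForm (riemannianVolumeForm (o i))) →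
    ∀ (b : ∀ x : M₀, OrthonormalBasis (Fin n) ℝ (TangentSpace 𝓘(ℝ, E₀) x)),
      (∀ x, (b x).toBasis.orientation = o₀ x) →
      (∀ i x, Orientation.map (Fin n)
        ((Φ i).mfderivToContinuousLinearEquiv (by simp) x).toLinearEquiv (o₀ x) = o i (Φ i x)) →
      (∀ i x j l, |⟪mfderiv 𝓘(ℝ, E₀) 𝓘(ℝ, Em i) (Φ i) x (b x j),
          mfderiv 𝓘(ℝ, E₀) 𝓘(ℝ, Em i) (Φ i) x (b x l)⟫_ℝ - (if j = l then 1 else 0)| ≤ δ i) →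
      (∀ i x, ‖(tangentJ (Em i) (Φ i x)).comp (mfderiv 𝓘(ℝ, E₀) 𝓘(ℝ, Em i) (Φ i) x) -
          (mfderiv 𝓘(ℝ, E₀) 𝓘(ℝ, Em i) (Φ i) x).comp (tangentJ E₀ x)‖ ≤ κ i) →
      (∀ i, N ≤ finrank ℂ ↥(hodgePQ (Em i) (Mf i) k p q)) →
      N ≤ finrank ℂ ↥(hodgePQ E₀ M₀ k p q) := by
  letI i₀ : RiemannianBundle (fun x : M₀ ↦ TangentSpace 𝓘(ℝ, E₀) x) := ⟨g₀.toRiemannianMetric⟩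
  letI iM : ∀ i, RiemannianBundle (fun y : Mf i ↦ TangentSpace 𝓘(ℝ, Em i) y) :=
    fun i ↦ ⟨(g i).toRiemannianMetric⟩
  intro ho₀ ho b hb hΦ hT hJ hN
  haveI : IsContMDiffRiemannianBundle 𝓘(ℝ, E₀) ∞ E₀ (fun x : M₀ ↦ TangentSpace 𝓘(ℝ, E₀) x) :=
    ⟨g₀.inner, g₀.contMDiff, fun _ _ _ ↦ rfl⟩
  haveI iMs : ∀ i, IsContMDiffRiemannianBundle 𝓘(ℝ, Em i) ∞ (Em i)
      (fun y : Mf i ↦ TangentSpace 𝓘(ℝ, Em i) y) :=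
    fun i ↦ ⟨(g i).inner, (g i).contMDiff, fun _ _ _ ↦ rfl⟩
  haveI : Fact (IsSmoothForm (riemannianVolumeForm o₀)) := ⟨ho₀⟩
  classical
  -- the degenerate type: `K^{p,q} = 0` on the `M_i`, so `N = 0`
  by_cases hpq : p + q = k
  swap
  · have h0 : finrank ℂ ↥(hodgePQ (Em 0) (Mf 0) k p q) = 0 := by
      rw [hodgePQ_eq_bot_of_ne hpq, finrank_bot]
    have := hN 0
    omega
  -- Hermitian metrics: rotations are isometries, `J` commutes estimates
  have hJ₀ : ∀ (x : M₀) (v w : TangentSpace 𝓘(ℝ, E₀) x), ⟪tangentJ E₀ x v, tangentJ E₀ x w⟫_ℝ = ⟪v, w⟫_ℝ :=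
    fun x v w ↦ hg₀.isHermitian x v w
  have hJM : ∀ i (y : Mf i) (v w : TangentSpace 𝓘(ℝ, Em i) y),
      ⟪tangentJ (Em i) y v, tangentJ (Em i) y w⟫_ℝ = ⟪v, w⟫_ℝ :=
    fun i y v w ↦ (hg i).isHermitian y v w
  /- ### The Hilbert-space data on `M₀` -/
  -- harmonic and exact forms inside `V = A^k(M₀; ℂ)`
  let Hs : Submodule ℂ (CL2SmoothForms o₀ k) := (charmonicForms o₀ h).comap (CL2SmoothForms.toFormₗ o₀)
  let Ds : Submodule ℂ (CL2SmoothForms o₀ k) :=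
    (cexactSmoothForms E₀ M₀ k).comap (CL2SmoothForms.toFormₗ o₀)
  have hHs : ∀ v : CL2SmoothForms o₀ k, v ∈ Hs ↔ IsCHarmonicForm o₀ h (CL2SmoothForms.toForm o₀ v) := by
    intro v
    change CL2SmoothForms.toForm o₀ v ∈ charmonicForms o₀ h ↔ _
    exact mem_charmonicForms_iff_of_contMDiffMetric o₀ ho₀ h _
  have hDs : ∀ v : CL2SmoothForms o₀ k, v ∈ Ds ↔ CL2SmoothForms.toForm o₀ v ∈ cexactSmoothForms E₀ M₀ k :=
    fun v ↦ Iff.rfl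
  have htoForm_inj : ∀ a b : CL2SmoothForms o₀ k,
      CL2SmoothForms.toForm o₀ a = CL2SmoothForms.toForm o₀ b → a = b := fun a b hab ↦ Subtype.ext hab
  -- closedness of harmonic forms
  have hclosed : ∀ {α : MForm 𝓘(ℝ, E₀) M₀ ℂ k}, IsCHarmonicForm o₀ h α → α ∈ cclosedSmoothForms E₀ M₀ k :=
    fun hα ↦ (mem_cclosedSmoothForms_iff _).2 ⟨hα.1, mextDeriv_eq_zero_of_isCHarmonicForm o₀ ho₀ h hα⟩
  -- `H` is finite-dimensional: it injects into `H^k_dR(M₀; ℂ)`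
  haveI : FiniteDimensional ℂ Hs := by
    haveI : Module.Finite ℂ (complexDeRhamCohomology E₀ M₀ k) :=
      complexDeRhamCohomology.finite_of_compactSpace E₀ M₀ k
    let ψ₀ : Hs →ₗ[ℂ] ↥(cclosedSmoothForms E₀ M₀ k) :=
      { toFun := fun v ↦ ⟨CL2SmoothForms.toForm o₀ v.1, hclosed ((hHs v.1).1 v.2)⟩
        map_add' := fun _ _ ↦ rfl
        map_smul' := fun _ _ ↦ rfl }
    let ψ : Hs →ₗ[ℂ] complexDeRhamCohomology E₀ M₀ k := (complexDeRhamCohomology.mk E₀ M₀ k).comp ψ₀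
    refine Module.Finite.of_injective ψ ?_
    rw [← LinearMap.ker_eq_bot, LinearMap.ker_eq_bot']
    intro v hv
    have hex : CL2SmoothForms.toForm o₀ v.1 ∈ cexactSmoothForms E₀ M₀ k := by
      have h' := (complexDeRhamCohomology.mk_eq_mk_iff (ψ₀ v) 0).1 (by
        change ψ v = complexDeRhamCohomology.mk E₀ M₀ k 0
        rw [hv, _root_.map_zero])
      simp only [Submodule.coe_zero, sub_zero] at h'
      exact h'
    have h0 := eq_zero_of_isCHarmonicForm_of_mem_cexactSmoothForms o₀ ho₀ h ((hHs v.1).1 v.2) hex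
    exact Subtype.ext (htoForm_inj _ _ (by rw [h0]; rfl))
  -- harmonic ⊥ exact
  have hHD : ∀ hh ∈ Hs, ∀ d ∈ Ds, ⟪hh, d⟫_ℂ = 0 := by
    intro hh hhh d hd
    rw [CL2SmoothForms.inner_def]
    exact cl2Inner_eq_zero_of_isCHarmonicForm_of_mem_cexactSmoothForms o₀ ho₀ h ((hHs hh).1 hhh) hd
  -- the type projector
  obtain ⟨L, hL⟩ := exists_typeProjector_clm (k := k) o₀ hJ₀ p q
  /- ### Harmonic `(p,q)`-frames on the `M_i` and their transports -/
  have hframe : ∀ i, ∃ u : Fin N → MForm 𝓘(ℝ, Em i) (Mf i) ℂ k, LinearIndependent ℂ u ∧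
      ∀ j, u j ∈ cclosedSmoothForms (Em i) (Mf i) k ∧ IsCHarmonicForm (o i) h (u j) ∧
        IsOfType p q (u j) := by
    intro i
    obtain ⟨u, hu, hu'⟩ :=
      exists_linearIndependent_isCHarmonicForm_isOfType (g i) (o i) (hg i) h p q (ho i)
    exact ⟨u ∘ Fin.castLE (hN i), hu.comp _ (Fin.castLE_injective _), fun j ↦ hu' _⟩
  choose u hu_li hu_prop using hframe
  have hu_smooth : ∀ i j, IsSmoothForm (u i j) := fun i j ↦ (hu_prop i j).2.1.1
  have hwu : ∀ i j, IsSmoothForm ((u i j).pullback 𝓘(ℝ, E₀) (Φ i)) := fun i j ↦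
    isSmoothForm_pullback (Φ i).contMDiff (hu_smooth i j)
  let f : ∀ i, Fin N → CL2SmoothForms o₀ k := fun i j ↦
    CL2SmoothForms.mk o₀ ((u i j).pullback 𝓘(ℝ, E₀) (Φ i)) (hwu i j)
  -- pull-back algebra along `Φ_i` and `Φ_i⁻¹`
  have hpb_symm : ∀ i (γ : MForm 𝓘(ℝ, Em i) (Mf i) ℂ k),
      (γ.pullback 𝓘(ℝ, E₀) (Φ i)).pullback 𝓘(ℝ, Em i) (Φ i).symm = γ := by
    intro i γ
    rw [← MForm.pullback_comp ((Φ i).mdifferentiable (by simp)) ((Φ i).symm.mdifferentiable (by simp))]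
    have : ((Φ i : M₀ → Mf i) ∘ ((Φ i).symm : Mf i → M₀)) = id := funext fun y ↦ (Φ i).apply_symm_apply y
    rw [this, MForm.pullback_id]
  -- elements of the span of the transported frame
  have hspan : ∀ i (w : CL2SmoothForms o₀ k), w ∈ Submodule.span ℂ (Set.range (f i)) →
      ∃ c : Fin N → ℂ, CL2SmoothForms.toForm o₀ w = (∑ j, c j • u i j).pullback 𝓘(ℝ, E₀) (Φ i) := by
    intro i w hw
    obtain ⟨c, rfl⟩ := (Submodule.mem_span_range_iff_exists_fun ℂ).1 hw
    refine ⟨c, ?_⟩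
    rw [← CL2SmoothForms.toFormₗ_apply, _root_.map_sum, ← MForm.cpullbackₗ_apply, _root_.map_sum]
    refine Finset.sum_congr rfl fun j _ ↦ ?_
    rw [map_smul, map_smul]
    rfl
  have hU : ∀ i (c : Fin N → ℂ), IsCHarmonicForm (o i) h (∑ j, c j • u i j) ∧
      IsOfType p q (∑ j, c j • u i j) ∧ (∑ j, c j • u i j) ∈ cclosedSmoothForms (Em i) (Mf i) k := by
    intro i c
    refine ⟨?_, ?_, Submodule.sum_mem _ fun j _ ↦ Submodule.smul_mem _ _ (hu_prop i j).1⟩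
    · induction (Finset.univ : Finset (Fin N)) using Finset.induction_on with
      | empty => simpa using isCHarmonicForm_zero (o i) h
      | insert j s hj ih =>
        rw [Finset.sum_insert hj]
        exact ((hu_prop i j).2.1.smul (o i) h (c j)).add (o i) (ho i) h ih
    · induction (Finset.univ : Finset (Fin N)) using Finset.induction_on with
      | empty => simpa using isOfType_zero hpq
      | insert j s hj ih =>
        rw [Finset.sum_insert hj]
        exact ((hu_prop i j).2.2.smul (c j)).add ih
  /- ### A subsequence along which all defects are quantitatively small -/
  have hC := fun mm : ℕ ↦ exists_forall_norm_cl2Inner_transport_sub_le o₀ ho₀ b hb k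
    (ε := 1 / ((mm : ℝ) + 1)) (by positivity)
  choose δ₁ hδ₁pos hδ₁ using hC
  have hev : ∀ mm : ℕ, ∃ i, δ i ≤ min (δ₁ mm) (1 / (4 * (n : ℝ) + 4)) ∧ κ i ≤ 1 / ((mm : ℝ) + 1) := by
    intro mm
    have h1 : ∀ᶠ i in atTop, δ i ≤ min (δ₁ mm) (1 / (4 * (n : ℝ) + 4)) :=
      (hδ.eventually (Iic_mem_nhds (lt_min (hδ₁pos mm) (by positivity)))).mono fun i hi ↦ hi
    have h2 : ∀ᶠ i in atTop, κ i ≤ 1 / ((mm : ℝ) + 1) :=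
      (hκ.eventually (Iic_mem_nhds (by positivity))).mono fun i hi ↦ hi
    exact (h1.and h2).exists
  choose ix hφδ hφκ using hev
  have hφδ₁ : ∀ mm, δ (ix mm) ≤ δ₁ mm := fun mm ↦ (hφδ mm).trans (min_le_left _ _)
  have hφn : ∀ mm, (n : ℝ) * δ (ix mm) ≤ 3 / 4 := by
    intro mm
    have h1 : δ (ix mm) ≤ 1 / (4 * (n : ℝ) + 4) := (hφδ mm).trans (min_le_right _ _)
    have hn : (0 : ℝ) ≤ n := n.cast_nonneg
    have h2 : (n : ℝ) * δ (ix mm) ≤ n * (1 / (4 * (n : ℝ) + 4)) := mul_le_mul_of_nonneg_left h1 hn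
    have h3 : (n : ℝ) * (1 / (4 * (n : ℝ) + 4)) ≤ 1 / 4 := by
      rw [mul_one_div, div_le_iff₀ (by positivity)]
      linarith
    linarith
  /- ### Operator bounds for `DΦ_i` along the subsequence -/
  have hTnorm : ∀ mm x, ‖(mfderiv 𝓘(ℝ, E₀) 𝓘(ℝ, Em (ix mm)) (Φ (ix mm)) x)‖ ≤ 2 := by
    intro mm x
    refine ContinuousLinearMap.opNorm_le_bound _ zero_le_two fun v ↦ ?_
    have h1 := abs_norm_sq_map_sub_le_of_gram (mfderiv 𝓘(ℝ, E₀) 𝓘(ℝ, Em (ix mm)) (Φ (ix mm)) x)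
      (b x) (hδ0 _) (hT (ix mm) x) v
    have h2 : ‖mfderiv 𝓘(ℝ, E₀) 𝓘(ℝ, Em (ix mm)) (Φ (ix mm)) x v‖ ^ 2 ≤ (2 * ‖v‖) ^ 2 := by
      have := (abs_le.1 h1).2
      nlinarith [hφn mm, sq_nonneg ‖v‖, mul_nonneg (hδ0 (ix mm)) (sq_nonneg ‖v‖)]
    exact (pow_le_pow_iff_left₀ (norm_nonneg _) (by positivity) two_ne_zero).1 h2
  have hSnorm : ∀ mm x, ‖(((Φ (ix mm)).mfderivToContinuousLinearEquiv (by simp) x).symm :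
      TangentSpace 𝓘(ℝ, Em (ix mm)) (Φ (ix mm) x) →L[ℝ] TangentSpace 𝓘(ℝ, E₀) x)‖ ≤ 2 := fun mm x ↦
    norm_symm_le_two_of_gram ((Φ (ix mm)).mfderivToContinuousLinearEquiv (by simp) x) (b x)
      (hδ0 _) (hφn mm) (hT (ix mm) x)
  have hA : ∀ mm x (θ : ℝ), ‖(tangentRotate (Em (ix mm)) (Φ (ix mm) x) θ).comp
      (mfderiv 𝓘(ℝ, E₀) 𝓘(ℝ, Em (ix mm)) (Φ (ix mm)) x)‖ ≤ 2 := fun mm x θ ↦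
    (ContinuousLinearMap.opNorm_comp_le _ _).trans (by
      have := norm_tangentRotate_le_one (hJM (ix mm) (Φ (ix mm) x)) θ
      have := hTnorm mm x
      nlinarith [norm_nonneg (tangentRotate (Em (ix mm)) (Φ (ix mm) x) θ),
        norm_nonneg (mfderiv 𝓘(ℝ, E₀) 𝓘(ℝ, Em (ix mm)) (Φ (ix mm)) x)])
  have hB : ∀ mm x (θ : ℝ), ‖(mfderiv 𝓘(ℝ, E₀) 𝓘(ℝ, Em (ix mm)) (Φ (ix mm)) x).comp
      (tangentRotate E₀ x θ)‖ ≤ 2 := fun mm x θ ↦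
    (ContinuousLinearMap.opNorm_comp_le _ _).trans (by
      have := norm_tangentRotate_le_one (hJ₀ x) θ
      have := hTnorm mm x
      nlinarith [norm_nonneg (tangentRotate E₀ x θ),
        norm_nonneg (mfderiv 𝓘(ℝ, E₀) 𝓘(ℝ, Em (ix mm)) (Φ (ix mm)) x)])
  have hAB : ∀ mm x (θ : ℝ), ‖(tangentRotate (Em (ix mm)) (Φ (ix mm) x) θ).comp
      (mfderiv 𝓘(ℝ, E₀) 𝓘(ℝ, Em (ix mm)) (Φ (ix mm)) x) -
      (mfderiv 𝓘(ℝ, E₀) 𝓘(ℝ, Em (ix mm)) (Φ (ix mm)) x).comp (tangentRotate E₀ x θ)‖ ≤ κ (ix mm) :=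
    fun mm x θ ↦ (norm_tangentRotate_comp_sub_comp_tangentRotate_le _ θ).trans (hJ (ix mm) x)
  /- ### The data of the abstract lemma -/
  set Cst : ℝ := 4 * (n : ℝ) ^ (2 * k) * ((k : ℝ) * 2 ^ (k - 1) * 2 ^ k) ^ 2 with hCst
  have hCst0 : 0 ≤ Cst := by positivity
  let W : ℕ → Submodule ℂ (CL2SmoothForms o₀ k) := fun mm ↦ Submodule.span ℂ (Set.range (f (ix mm)))
  let B : ℕ → CL2SmoothForms o₀ k → CL2SmoothForms o₀ k → ℂ := fun mm d w ↦
    MForm.cl2Inner (o (ix mm))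
      ((CL2SmoothForms.toForm o₀ d).pullback 𝓘(ℝ, Em (ix mm)) (Φ (ix mm)).symm)
      ((CL2SmoothForms.toForm o₀ w).pullback 𝓘(ℝ, Em (ix mm)) (Φ (ix mm)).symm)
  let Lᵢ : ℕ → CL2SmoothForms o₀ k → CL2SmoothForms o₀ k := fun _ w ↦ w
  let ε : ℕ → ℝ := fun mm ↦ 2 * (1 / ((mm : ℝ) + 1))
  let η : ℕ → ℝ := fun mm ↦ Real.sqrt Cst * (1 / ((mm : ℝ) + 1))
  have hε : Tendsto ε atTop (𝓝 0) := by
    show Tendsto (fun mm : ℕ ↦ 2 * (1 / ((mm : ℝ) + 1))) atTop (𝓝 0)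
    simpa using (tendsto_one_div_add_atTop_nhds_zero_nat).const_mul (2 : ℝ)
  have hη : Tendsto η atTop (𝓝 0) := by
    show Tendsto (fun mm : ℕ ↦ Real.sqrt Cst * (1 / ((mm : ℝ) + 1))) atTop (𝓝 0)
    simpa using (tendsto_one_div_add_atTop_nhds_zero_nat).const_mul (Real.sqrt Cst)
  -- `W_i ⊆ H ⊕ D` (Hodge decomposition on `M₀`)
  have hW : ∀ mm, W mm ≤ Hs ⊔ Ds := by
    intro mm
    refine Submodule.span_le.2 ?_
    rintro _ ⟨j, rfl⟩
    have hcl : (u (ix mm) j).pullback 𝓘(ℝ, E₀) (Φ (ix mm)) ∈ cclosedSmoothForms E₀ M₀ k :=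
      pullback_mem_cclosedSmoothForms (Φ (ix mm)).contMDiff (hu_prop (ix mm) j).1
    obtain ⟨α, hαc, hαh, hex⟩ :=
      exists_isCHarmonicForm_sub_mem_cexactSmoothForms g₀ o₀ hg₀ h hcl ho₀
    have hsplit : f (ix mm) j = CL2SmoothForms.mk o₀ α hαh.1 +
        CL2SmoothForms.mk o₀ ((u (ix mm) j).pullback 𝓘(ℝ, E₀) (Φ (ix mm)) - α)
          ((hwu (ix mm) j).sub hαh.1) := htoForm_inj _ _ (by
      simp only [f, CL2SmoothForms.toForm_add, CL2SmoothForms.toForm_mk, add_sub_cancel])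
    rw [SetLike.mem_coe, hsplit]
    exact Submodule.add_mem_sup ((hHs _).2 hαh) ((hDs _).2 hex)
  -- `B_i(D, W_i) = 0` (harmonic ⊥ exact on `M_i`)
  have hB0 : ∀ mm, ∀ w ∈ W mm, ∀ d ∈ Ds, B mm d w = 0 := by
    intro mm w hw d hd
    obtain ⟨c, hc⟩ := hspan (ix mm) w hw
    have hw' : (CL2SmoothForms.toForm o₀ w).pullback 𝓘(ℝ, Em (ix mm)) (Φ (ix mm)).symm =
        ∑ j, c j • u (ix mm) j := by rw [hc, hpb_symm]
    have hd' : (CL2SmoothForms.toForm o₀ d).pullback 𝓘(ℝ, Em (ix mm)) (Φ (ix mm)).symm ∈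
        cexactSmoothForms (Em (ix mm)) (Mf (ix mm)) k :=
      pullback_mem_cexactSmoothForms (Φ (ix mm)).symm.contMDiff ((hDs d).1 hd)
    change MForm.cl2Inner (o (ix mm)) _ _ = 0
    rw [hw', ← MForm.cl2Inner_conj_symm,
      cl2Inner_eq_zero_of_isCHarmonicForm_of_mem_cexactSmoothForms (o (ix mm)) (ho _) h
        (hU (ix mm) c).1 hd', _root_.map_zero]
  -- `|B_i - ( , )| ≤ ε_i (‖d‖² + ‖w‖²)`
  have hBε : ∀ mm, ∀ w ∈ W mm, ∀ d ∈ Ds, ‖B mm d w - ⟪d, w⟫_ℂ‖ ≤ ε mm * (‖d‖ ^ 2 + ‖w‖ ^ 2) := by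
    intro mm w _ d _
    have key := hδ₁ mm (o (ix mm)) (ho _) (Φ (ix mm)) (hΦ (ix mm)) (hδ0 _) (hφδ₁ mm) (hT (ix mm))
      (CL2SmoothForms.isSmoothForm_toForm o₀ d) (CL2SmoothForms.isSmoothForm_toForm o₀ w)
    rw [CL2SmoothForms.inner_def, CL2SmoothForms.norm_sq_eq, CL2SmoothForms.norm_sq_eq]
    simpa only [ε, mul_assoc] using key
  have hLfix : ∀ mm, ∀ w ∈ W mm, Lᵢ mm w = w := fun _ _ _ ↦ rfl
  -- `‖w - L w‖ ≤ η_i ‖w‖` on `W_i` (transported `(p,q)`-forms are almost of type `(p,q)`)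
  have hLη : ∀ mm, ∀ w ∈ W mm, ‖Lᵢ mm w - L w‖ ≤ η mm * ‖w‖ := by
    intro mm w hw
    obtain ⟨c, hc⟩ := hspan (ix mm) w hw
    set U := ∑ j, c j • u (ix mm) j with hUdef
    have hUs : IsSmoothForm U := (hU (ix mm) c).1.1
    have hdef := re_cl2Inner_typeDefect_le (k := k) o₀ ho₀ (Φ (ix mm)) hUs (hU (ix mm) c).2.1
      (Λ := 2) (σ := 2) (κ := κ (ix mm)) zero_le_two (hκ0 _) (hSnorm mm)
      (fun x j ↦ hA mm x _) (fun x j ↦ hB mm x _) (fun x j ↦ hAB mm x _)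
    -- `w - L w` has underlying form `Φ^*U - (Φ^*U)^{p,q}`
    have hform : CL2SmoothForms.toForm o₀ (Lᵢ mm w - L w) =
        U.pullback 𝓘(ℝ, E₀) (Φ (ix mm)) - (U.pullback 𝓘(ℝ, E₀) (Φ (ix mm))).typeComponent p q := by
      change CL2SmoothForms.toForm o₀ (w - L w) = _
      rw [← CL2SmoothForms.toFormₗ_apply, map_sub, CL2SmoothForms.toFormₗ_apply,
        CL2SmoothForms.toFormₗ_apply, hL, hc]
    have hsq : ‖Lᵢ mm w - L w‖ ^ 2 ≤ (Real.sqrt Cst * (1 / ((mm : ℝ) + 1)) * ‖w‖) ^ 2 := by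
      rw [CL2SmoothForms.norm_sq_eq, hform, mul_pow, mul_pow, Real.sq_sqrt hCst0,
        CL2SmoothForms.norm_sq_eq, hc]
      refine hdef.trans ?_
      have hre0 : 0 ≤ (MForm.cl2Inner o₀ (U.pullback 𝓘(ℝ, E₀) (Φ (ix mm)))
          (U.pullback 𝓘(ℝ, E₀) (Φ (ix mm)))).re := by
        rw [← hc, ← CL2SmoothForms.norm_sq_eq]; positivity
      have hκle : κ (ix mm) ^ 2 ≤ (1 / ((mm : ℝ) + 1)) ^ 2 :=
        pow_le_pow_left₀ (hκ0 _) (hφκ mm) 2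
      calc 4 * (n : ℝ) ^ (2 * k) * ((k : ℝ) * 2 ^ (k - 1) * 2 ^ k) ^ 2 * κ (ix mm) ^ 2 *
            (MForm.cl2Inner o₀ (U.pullback 𝓘(ℝ, E₀) (Φ (ix mm))) (U.pullback 𝓘(ℝ, E₀) (Φ (ix mm)))).re
          = Cst * κ (ix mm) ^ 2 *
            (MForm.cl2Inner o₀ (U.pullback 𝓘(ℝ, E₀) (Φ (ix mm))) (U.pullback 𝓘(ℝ, E₀) (Φ (ix mm)))).re := by
            rw [hCst]
        _ ≤ Cst * (1 / ((mm : ℝ) + 1)) ^ 2 *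
            (MForm.cl2Inner o₀ (U.pullback 𝓘(ℝ, E₀) (Φ (ix mm))) (U.pullback 𝓘(ℝ, E₀) (Φ (ix mm)))).re :=
            mul_le_mul_of_nonneg_right (mul_le_mul_of_nonneg_left hκle hCst0) hre0
    have hη0 : 0 ≤ Real.sqrt Cst * (1 / ((mm : ℝ) + 1)) * ‖w‖ := by positivity
    exact (pow_le_pow_iff_left₀ (norm_nonneg _) hη0 two_ne_zero).1 hsq
  -- `N` independent vectors in every `W_i`
  have hNW : ∀ mm, ∃ fv : Fin N → CL2SmoothForms o₀ k, LinearIndependent ℂ fv ∧ ∀ j, fv j ∈ W mm := by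
    intro mm
    refine ⟨f (ix mm), ?_, fun j ↦ Submodule.subset_span ⟨j, rfl⟩⟩
    rw [Fintype.linearIndependent_iff]
    intro a ha j
    -- apply `toForm` and pull back along `Φ⁻¹`
    have h1 : CL2SmoothForms.toForm o₀ (∑ i, a i • f (ix mm) i) =
        (∑ i, a i • u (ix mm) i).pullback 𝓘(ℝ, E₀) (Φ (ix mm)) := by
      rw [← CL2SmoothForms.toFormₗ_apply, _root_.map_sum, ← MForm.cpullbackₗ_apply, _root_.map_sum]
      refine Finset.sum_congr rfl fun i _ ↦ ?_
      rw [map_smul, map_smul]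
      rfl
    have h2 : (∑ i, a i • u (ix mm) i) = 0 := by
      have := congrArg (fun γ ↦ MForm.pullback 𝓘(ℝ, Em (ix mm)) (Φ (ix mm)).symm γ) h1
      simp only [hpb_symm] at this
      rw [← this, ha]
      change MForm.pullback 𝓘(ℝ, Em (ix mm)) (Φ (ix mm)).symm (0 : MForm 𝓘(ℝ, E₀) M₀ ℂ k) = 0
      exact MForm.pullback_zero _
    exact (Fintype.linearIndependent_iff.1 (hu_li (ix mm))) a h2 j
  /- ### The limiting argument and the conclusion -/
  obtain ⟨fv, hfv_li, hfv⟩ := exists_linearIndependent_of_subspaces Hs Ds hHD L W B Lᵢ ε η hε hη hW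
    hB0 hBε hLfix hLη hNW
  -- the limiting forms: independent, harmonic, of type `(p,q)`
  let U₀ : Fin N → MForm 𝓘(ℝ, E₀) M₀ ℂ k := fun j ↦ CL2SmoothForms.toForm o₀ (fv j)
  have hU₀_li : LinearIndependent ℂ U₀ := by
    have hker : LinearMap.ker (CL2SmoothForms.toFormₗ o₀ (k := k)) = ⊥ :=
      LinearMap.ker_eq_bot.2 fun a b hab ↦ htoForm_inj a b hab
    exact hfv_li.map' (CL2SmoothForms.toFormₗ o₀) hker
  have hU₀_harm : ∀ j, IsCHarmonicForm o₀ h (U₀ j) := fun j ↦ (hHs _).1 (hfv j).1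
  have hU₀_type : ∀ j, IsOfType p q (U₀ j) := by
    intro j
    refine (isOfType_iff_typeComponent_eq_self_holds hpq (U₀ j)).2 ?_
    have := congrArg (CL2SmoothForms.toForm o₀) (hfv j).2
    rwa [hL] at this
  exact le_finrank_hodgePQ_of_linearIndependent g₀ o₀ h U₀ hU₀_li hU₀_type ho₀ hU₀_harm

end Literature.AlgebraicGeometry.Motives
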